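import Mathlib
import HarnessLib
import Summits.Ventures.LatticeQCDFlow.Exactness.SU2ClosedFormExponential
import Summits.Ventures.LatticeQCDFlow.Exactness.SU2KickJacobian

/-!
# The engine's fixed-point inverse of an `SU(2)` kick sub-step is a `κ`-contraction: geometric convergence to the unique preimage at rate `κ = |c|‖J‖`

HONEST FRAMING: exact (Metropolis-corrected) sampling algorithms for lattice gauge theory;
figures of merit are autocorrelation/cost numbers at stated couplings and volumes; no
continuum-physics claim.

Venture `LatticeQCDFlow` (cell pub-lqcd), topic `Exactness`; FANOUT row 14 (`eng-flowhmc`, engine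
`latflow.fthmc`, family B).  NEW WORK of the cell; nothing is cited as a fact; no number.  The
engine inverts a masked sub-step link by link (`maps.wflow_substep_inverse_flat`,
`resid_substep_inverse_flat`, `_stout_sublayer_inverse`: "fixed-point iteration
`U_{k+1} = e^{+ε TA(U_k R)} U'` … a contraction"; the printed counterpart, NAMED ONLY, is Lüscher,
Commun. Math. Phys. 293 (2010) App. D).  With the staples frozen, the forward map of one link is
the kick `F(U) = gaussUnit (geodesicKick c J (vecQuat U)) = exp(X(U)) · U`,
`X(U) = (c/2)(Q_J Uᴴ − (Q_J Uᴴ)ᴴ)` (`SU2ClosedFormExponential.coe_su2Substep_eq_exp_mul`), and the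
engine's iteration map for the target `U'` is `T(U) = exp(−X(U)) · U' = U · F(U)⁻¹ · U'`.
GEN-7 typed bijectivity of `F` for `|c|‖J‖ ≤ 1` (`bijective_su2Kick`); the convergence RATE of
the engine's inverse was listed NOT CLAIMED.  Here it is, in the quaternion coordinates of
`HaarSU2Gaussian.lean` (Euclidean norm of `ℝ⁴`, i.e. `‖A‖_F/√2` on `2 × 2` quaternion matrices):

* quaternion bookkeeping: `vecQuat_sub`, `isQuat_sub`, `normSq_conjTranspose_quat`,
  `norm_vecQuat_conjTranspose`, `normSq_mul_quat`, `norm_vecQuat_mul` (`|AB| = |A||B|`),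
  `sqrt_imSq_le_norm`;
* **`norm_closedForm_sub_closedForm_le`** — the closed-form unit-quaternion exponential
  `y ↦ (cos(c|y|), c sinc(c|y|) y)` is `|c|`-Lipschitz from `ℝ³` to `S³ ⊂ ℝ⁴` (elementary:
  Cauchy–Schwarz, `|sinc| ≤ 1`, `1 − cos x ≤ x²/2`); `norm_closedForm_eq_one`;
* `coe_kick_mul_inv_eq_exp`, `exp_skew_eq_coe_gaussUnit_closedForm`, `vecQuat_kick_mul_inv` — the
  left factor `E(U) = F(U) U⁻¹` IS `exp(X(U))`, whose quaternion coordinates are the closed form at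
  `y = Im (Q_J Uᴴ)`;
* **`coe_su2FixedPointMap_eq_exp_neg_mul`** — `U · F(U)⁻¹ · U' = exp(−X(U)) · U'`: the typed map IS
  the engine's `expm(-Q_of(U)) @ U_out`;
* **`su2FixedPointMap_lipschitz`** — `‖T U₁ − T U₂‖ ≤ |c|‖J‖ · ‖U₁ − U₂‖` for ALL `U₁, U₂, U'`:
  a contraction as soon as `κ = |c|‖J‖ < 1` (the layer's refusal rule);
* `su2FixedPointMap_eq_self_iff` (`T U = U ↔ F U = U'`), **`su2FixedPoint_iterate_le`**
  (`‖T^[n] U₀ − U⋆‖ ≤ κⁿ ‖U₀ − U⋆‖` for the preimage `U⋆`), **`su2FixedPoint_converges`** (for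
  `κ ≤ 1` the preimage exists uniquely and `‖T^[n] U₀ − U⋆‖ ≤ 2κⁿ` from any start, e.g. the
  engine's `U₀ = U'`).

NOT CLAIMED: floating point; the engine's `n_iter = 64` being enough for a given residual (that is
`2κ⁶⁴` here, a bound, not a measurement); `SU(N ≥ 3)`; any number.
-/

noncomputable section

namespace Summit.Ventures.LatticeQCDFlow.Exactness

open Real InnerProductGeometry WithLp NormedSpace
open Literature.MathematicalPhysics.QuantumFieldTheory
open scoped Matrix

/-! ## Quaternion bookkeeping -/

section Quat

/-- `vecQuat` is additive: differences. -/
theorem vecQuat_sub (M N : Matrix (Fin 2) (Fin 2) ℂ) : vecQuat (M - N) = vecQuat M - vecQuat N := by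
  have h := vecQuat_add (M - N) N
  rw [sub_add_cancel] at h
  rw [h, add_sub_cancel_right]

/-- Differences of quaternions are quaternions. -/
theorem isQuat_sub {A B : Matrix (Fin 2) (Fin 2) ℂ} (hA : IsQuat A) (hB : IsQuat B) : IsQuat (A - B) :=
  ⟨by simp [Matrix.sub_apply, hA.diag, hB.diag], by simp [Matrix.sub_apply, hA.offdiag, hB.offdiag]; ring⟩

/-- The quaternion norm is invariant under the conjugate transpose (quaternion conjugation). -/
theorem normSq_conjTranspose_quat {M : Matrix (Fin 2) (Fin 2) ℂ} (hM : IsQuat M) :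
    IsQuat.normSq Mᴴ = IsQuat.normSq M := by
  simp [IsQuat.normSq, Matrix.conjTranspose_apply, hM.offdiag]

/-- `‖vecQuat Mᴴ‖ = ‖vecQuat M‖` for a quaternion `M`. -/
theorem norm_vecQuat_conjTranspose {M : Matrix (Fin 2) (Fin 2) ℂ} (hM : IsQuat M) :
    ‖vecQuat Mᴴ‖ = ‖vecQuat M‖ := by
  have h : ‖vecQuat Mᴴ‖ ^ 2 = ‖vecQuat M‖ ^ 2 := by
    rw [norm_vecQuat_sq, norm_vecQuat_sq, normSq_conjTranspose_quat hM]
  exact (pow_left_inj₀ (norm_nonneg _) (norm_nonneg _) two_ne_zero).1 h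

/-- The quaternion norm is multiplicative: `|A M|² = |A|² |M|²` (both sides are determinants). -/
theorem normSq_mul_quat {A M : Matrix (Fin 2) (Fin 2) ℂ} (hA : IsQuat A) (hM : IsQuat M) :
    IsQuat.normSq (A * M) = IsQuat.normSq A * IsQuat.normSq M := by
  have h := (hA.mul hM).det_eq
  rw [Matrix.det_mul, hA.det_eq, hM.det_eq] at h
  exact_mod_cast h.symm

/-- `‖vecQuat (A M)‖ = ‖vecQuat A‖ ‖vecQuat M‖` for quaternions `A`, `M`. -/
theorem norm_vecQuat_mul {A M : Matrix (Fin 2) (Fin 2) ℂ} (hA : IsQuat A) (hM : IsQuat M) :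
    ‖vecQuat (A * M)‖ = ‖vecQuat A‖ * ‖vecQuat M‖ := by
  have h : ‖vecQuat (A * M)‖ ^ 2 = (‖vecQuat A‖ * ‖vecQuat M‖) ^ 2 := by
    rw [mul_pow, norm_vecQuat_sq, norm_vecQuat_sq, norm_vecQuat_sq, normSq_mul_quat hA hM]
  exact (pow_left_inj₀ (norm_nonneg _) (mul_nonneg (norm_nonneg _) (norm_nonneg _)) two_ne_zero).1 h

/-- The imaginary part is shorter than the whole: `√(x₁² + x₂² + x₃²) ≤ ‖x‖` on `ℝ⁴`. -/
theorem sqrt_imSq_le_norm (x : R4) : √((x 1) ^ 2 + (x 2) ^ 2 + (x 3) ^ 2) ≤ ‖x‖ := by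
  rw [EuclideanSpace.norm_eq, Fin.sum_univ_four]
  simp only [Real.norm_eq_abs, sq_abs]
  exact Real.sqrt_le_sqrt (by linarith [sq_nonneg (x 0)])

end Quat

/-! ## The closed-form exponential is `|c|`-Lipschitz -/

section ClosedForm

/-- The closed-form point `(cos(c r), c sinc(c r) y)` (`r = |y|`) is a unit vector of `ℝ⁴`. -/
theorem norm_closedForm_eq_one (c y₁ y₂ y₃ : ℝ) :
    ‖(toLp 2 ![Real.cos (c * √(y₁ ^ 2 + y₂ ^ 2 + y₃ ^ 2)), c * sinc (c * √(y₁ ^ 2 + y₂ ^ 2 + y₃ ^ 2)) * y₁, c * sinc (c * √(y₁ ^ 2 + y₂ ^ 2 + y₃ ^ 2)) * y₂, c * sinc (c * √(y₁ ^ 2 + y₂ ^ 2 + y₃ ^ 2)) * y₃] : R4)‖ = 1 := by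
  set r : ℝ := √(y₁ ^ 2 + y₂ ^ 2 + y₃ ^ 2) with hr
  have hr2 : y₁ ^ 2 + y₂ ^ 2 + y₃ ^ 2 = r ^ 2 := (Real.sq_sqrt (by positivity)).symm
  have hms : c * r * sinc (c * r) = Real.sin (c * r) := Literature.Geometry.Riemannian.mul_sinc _
  have hv2 : ‖(toLp 2 ![Real.cos (c * √(y₁ ^ 2 + y₂ ^ 2 + y₃ ^ 2)), c * sinc (c * √(y₁ ^ 2 + y₂ ^ 2 + y₃ ^ 2)) * y₁, c * sinc (c * √(y₁ ^ 2 + y₂ ^ 2 + y₃ ^ 2)) * y₂, c * sinc (c * √(y₁ ^ 2 + y₂ ^ 2 + y₃ ^ 2)) * y₃] : R4)‖ ^ 2 = 1 := by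
    rw [EuclideanSpace.real_norm_sq_eq, Fin.sum_univ_four]
    simp only [Matrix.cons_val_zero, Matrix.cons_val_one, Matrix.cons_val]
    linear_combination Real.cos_sq_add_sin_sq (c * r) +
      (c * r * sinc (c * r) + Real.sin (c * r)) * hms + (c * sinc (c * r)) ^ 2 * hr2
  exact (pow_left_inj₀ (norm_nonneg _) zero_le_one two_ne_zero).1 (by rw [hv2, one_pow])

/-- **The closed-form unit-quaternion exponential is `|c|`-Lipschitz**: for all real `c`, `y`, `z`,
`‖(cos(c|y|), c sinc(c|y|) y) − (cos(c|z|), c sinc(c|z|) z)‖ ≤ |c| · |y − z|`.  (Elementary: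
with `R = c|y|`, `S = c|z|`, the squared left side is `2 − 2cos R cos S − 2 sinc R sinc S c² y·z`,
and `c² y·z ≤ RS`, `sinc R sinc S ≤ 1`, `RS sinc R sinc S = sin R sin S`, `1 − cos(R−S) ≤ (R−S)²/2`.) -/
theorem norm_closedForm_sub_closedForm_le (c y₁ y₂ y₃ z₁ z₂ z₃ : ℝ) :
    ‖(toLp 2 ![Real.cos (c * √(y₁ ^ 2 + y₂ ^ 2 + y₃ ^ 2)), c * sinc (c * √(y₁ ^ 2 + y₂ ^ 2 + y₃ ^ 2)) * y₁, c * sinc (c * √(y₁ ^ 2 + y₂ ^ 2 + y₃ ^ 2)) * y₂, c * sinc (c * √(y₁ ^ 2 + y₂ ^ 2 + y₃ ^ 2)) * y₃] : R4) -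
        (toLp 2 ![Real.cos (c * √(z₁ ^ 2 + z₂ ^ 2 + z₃ ^ 2)), c * sinc (c * √(z₁ ^ 2 + z₂ ^ 2 + z₃ ^ 2)) * z₁, c * sinc (c * √(z₁ ^ 2 + z₂ ^ 2 + z₃ ^ 2)) * z₂, c * sinc (c * √(z₁ ^ 2 + z₂ ^ 2 + z₃ ^ 2)) * z₃] : R4)‖ ≤
      |c| * √((y₁ - z₁) ^ 2 + (y₂ - z₂) ^ 2 + (y₃ - z₃) ^ 2) := by
  set r : ℝ := √(y₁ ^ 2 + y₂ ^ 2 + y₃ ^ 2) with hr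
  set s : ℝ := √(z₁ ^ 2 + z₂ ^ 2 + z₃ ^ 2) with hs
  have hr0 : 0 ≤ r := Real.sqrt_nonneg _
  have hs0 : 0 ≤ s := Real.sqrt_nonneg _
  have hr2 : r ^ 2 = y₁ ^ 2 + y₂ ^ 2 + y₃ ^ 2 := Real.sq_sqrt (by positivity)
  have hs2 : s ^ 2 = z₁ ^ 2 + z₂ ^ 2 + z₃ ^ 2 := Real.sq_sqrt (by positivity)
  have hR : c * r * sinc (c * r) = Real.sin (c * r) := Literature.Geometry.Riemannian.mul_sinc _
  have hS : c * s * sinc (c * s) = Real.sin (c * s) := Literature.Geometry.Riemannian.mul_sinc _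
  -- Cauchy–Schwarz in `ℝ³`
  have hL : (y₁ * z₁ + y₂ * z₂ + y₃ * z₃) ^ 2 ≤ (r * s) ^ 2 := by
    rw [mul_pow, hr2, hs2]
    nlinarith [sq_nonneg (y₁ * z₂ - y₂ * z₁), sq_nonneg (y₁ * z₃ - y₃ * z₁), sq_nonneg (y₂ * z₃ - y₃ * z₂)]
  have hCS : y₁ * z₁ + y₂ * z₂ + y₃ * z₃ ≤ r * s := (abs_le_of_sq_le_sq' hL (mul_nonneg hr0 hs0)).2
  -- the ingredients
  have hστ : sinc (c * r) * sinc (c * s) ≤ 1 := by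
    have h1 := abs_sinc_le_one (c * r)
    have h2 := abs_sinc_le_one (c * s)
    calc sinc (c * r) * sinc (c * s) ≤ |sinc (c * r) * sinc (c * s)| := le_abs_self _
      _ = |sinc (c * r)| * |sinc (c * s)| := abs_mul _ _
      _ ≤ 1 * 1 := mul_le_mul h1 h2 (abs_nonneg _) zero_le_one
      _ = 1 := one_mul _
  have hprod : 0 ≤ c ^ 2 * (r * s - (y₁ * z₁ + y₂ * z₂ + y₃ * z₃)) * (1 - sinc (c * r) * sinc (c * s)) :=
    mul_nonneg (mul_nonneg (sq_nonneg c) (sub_nonneg.2 hCS)) (sub_nonneg.2 hστ)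
  have hcos : 1 - (c * r - c * s) ^ 2 / 2 ≤ Real.cos (c * r - c * s) := Real.one_sub_sq_div_two_le_cos
  have hsub : Real.cos (c * r - c * s) = Real.cos (c * r) * Real.cos (c * s) + Real.sin (c * r) * Real.sin (c * s) :=
    Real.cos_sub _ _
  have h1 : Real.cos (c * r) ^ 2 + Real.sin (c * r) ^ 2 = 1 := Real.cos_sq_add_sin_sq _
  have h2 : Real.cos (c * s) ^ 2 + Real.sin (c * s) ^ 2 = 1 := Real.cos_sq_add_sin_sq _
  have e1 : c ^ 2 * sinc (c * r) ^ 2 * (y₁ ^ 2 + y₂ ^ 2 + y₃ ^ 2) = Real.sin (c * r) ^ 2 := by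
    rw [← hr2, ← hR]; ring
  have e2 : c ^ 2 * sinc (c * s) ^ 2 * (z₁ ^ 2 + z₂ ^ 2 + z₃ ^ 2) = Real.sin (c * s) ^ 2 := by
    rw [← hs2, ← hS]; ring
  have e4 : c ^ 2 * (r * s) * (sinc (c * r) * sinc (c * s)) = Real.sin (c * r) * Real.sin (c * s) := by
    rw [← hR, ← hS]; ring
  have e5 : c ^ 2 * r ^ 2 = c ^ 2 * (y₁ ^ 2 + y₂ ^ 2 + y₃ ^ 2) := by rw [hr2]
  have e6 : c ^ 2 * s ^ 2 = c ^ 2 * (z₁ ^ 2 + z₂ ^ 2 + z₃ ^ 2) := by rw [hs2]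
  -- the squared inequality
  have hsq : ‖(toLp 2 ![Real.cos (c * √(y₁ ^ 2 + y₂ ^ 2 + y₃ ^ 2)), c * sinc (c * √(y₁ ^ 2 + y₂ ^ 2 + y₃ ^ 2)) * y₁, c * sinc (c * √(y₁ ^ 2 + y₂ ^ 2 + y₃ ^ 2)) * y₂, c * sinc (c * √(y₁ ^ 2 + y₂ ^ 2 + y₃ ^ 2)) * y₃] : R4) -
        (toLp 2 ![Real.cos (c * √(z₁ ^ 2 + z₂ ^ 2 + z₃ ^ 2)), c * sinc (c * √(z₁ ^ 2 + z₂ ^ 2 + z₃ ^ 2)) * z₁, c * sinc (c * √(z₁ ^ 2 + z₂ ^ 2 + z₃ ^ 2)) * z₂, c * sinc (c * √(z₁ ^ 2 + z₂ ^ 2 + z₃ ^ 2)) * z₃] : R4)‖ ^ 2 ≤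
      (|c| * √((y₁ - z₁) ^ 2 + (y₂ - z₂) ^ 2 + (y₃ - z₃) ^ 2)) ^ 2 := by
    rw [mul_pow, sq_abs, Real.sq_sqrt (by positivity), EuclideanSpace.real_norm_sq_eq, Fin.sum_univ_four]
    simp only [PiLp.sub_apply, Matrix.cons_val_zero, Matrix.cons_val_one, Matrix.cons_val]
    -- the squared distance in closed form
    have hlhs : (Real.cos (c * r) - Real.cos (c * s)) ^ 2 + (c * sinc (c * r) * y₁ - c * sinc (c * s) * z₁) ^ 2 +
        (c * sinc (c * r) * y₂ - c * sinc (c * s) * z₂) ^ 2 + (c * sinc (c * r) * y₃ - c * sinc (c * s) * z₃) ^ 2 =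
        2 - 2 * (Real.cos (c * r) * Real.cos (c * s)) -
          2 * (sinc (c * r) * sinc (c * s)) * (c ^ 2 * (y₁ * z₁ + y₂ * z₂ + y₃ * z₃)) := by
      linear_combination h1 + h2 + e1 + e2
    rw [hlhs]
    linarith [hprod, hcos, hsub, e4, e5, e6]
  exact (pow_le_pow_iff_left₀ (norm_nonneg _) (by positivity) two_ne_zero).1 hsq

end ClosedForm

/-! ## The left factor `E(U) = F(U) U⁻¹` is `exp(X(U))`, a closed form -/

section LeftFactor

variable (U : Matrix.specialUnitaryGroup (Fin 2) ℂ) (c : ℝ) (J : R4)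

/-- `F(U) · U⁻¹ = exp(X(U))`, `X(U) = (c/2)(Q_J Uᴴ − (Q_J Uᴴ)ᴴ)` (from
`coe_su2Substep_eq_exp_mul`). -/
theorem coe_kick_mul_inv_eq_exp :
    ((gaussUnit (geodesicKick c J (vecQuat ((U : Matrix.specialUnitaryGroup (Fin 2) ℂ) : Matrix (Fin 2) (Fin 2) ℂ))) * U⁻¹ : Matrix.specialUnitaryGroup (Fin 2) ℂ) : Matrix (Fin 2) (Fin 2) ℂ) =
      exp ((((c / 2 : ℝ)) : ℂ) • (quatVec J * (U : Matrix (Fin 2) (Fin 2) ℂ)ᴴ - (quatVec J * (U : Matrix (Fin 2) (Fin 2) ℂ)ᴴ)ᴴ)) := by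
  rw [WilsonFlow.coe_mul_SU, WilsonFlow.coe_inv_SU, coe_su2Substep_eq_exp_mul, Matrix.mul_assoc,
    WilsonFlow.mul_conjTranspose_self_SU, Matrix.mul_one]

/-- `exp(X(U))` is the closed-form unit quaternion at `y = Im (Q_J Uᴴ)` (quaternion coordinates
`1, 2, 3` of `x = vecQuat (Q_J Uᴴ)`): `coe_gaussUnit_closedForm_eq_exp` read backwards through
`quatVec_im_eq_half_sub_conjTranspose`. -/
theorem exp_skew_eq_coe_gaussUnit_closedForm :
    exp ((((c / 2 : ℝ)) : ℂ) • (quatVec J * (U : Matrix (Fin 2) (Fin 2) ℂ)ᴴ - (quatVec J * (U : Matrix (Fin 2) (Fin 2) ℂ)ᴴ)ᴴ)) =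
      ((gaussUnit (toLp 2 ![Real.cos (c * √(vecQuat (quatVec J * ((U : Matrix.specialUnitaryGroup (Fin 2) ℂ) : Matrix (Fin 2) (Fin 2) ℂ)ᴴ) 1 ^ 2 + vecQuat (quatVec J * ((U : Matrix.specialUnitaryGroup (Fin 2) ℂ) : Matrix (Fin 2) (Fin 2) ℂ)ᴴ) 2 ^ 2 + vecQuat (quatVec J * ((U : Matrix.specialUnitaryGroup (Fin 2) ℂ) : Matrix (Fin 2) (Fin 2) ℂ)ᴴ) 3 ^ 2)), c * sinc (c * √(vecQuat (quatVec J * ((U : Matrix.specialUnitaryGroup (Fin 2) ℂ) : Matrix (Fin 2) (Fin 2) ℂ)ᴴ) 1 ^ 2 + vecQuat (quatVec J * ((U : Matrix.specialUnitaryGroup (Fin 2) ℂ) : Matrix (Fin 2) (Fin 2) ℂ)ᴴ) 2 ^ 2 + vecQuat (quatVec J * ((U : Matrix.specialUnitaryGroup (Fin 2) ℂ) : Matrix (Fin 2) (Fin 2) ℂ)ᴴ) 3 ^ 2)) * vecQuat (quatVec J * ((U : Matrix.specialUnitaryGroup (Fin 2) ℂ) : Matrix (Fin 2) (Fin 2)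 ℂ)ᴴ) 1, c * sinc (c * √(vecQuat (quatVec J * ((U : Matrix.specialUnitaryGroup (Fin 2) ℂ) : Matrix (Fin 2) (Fin 2) ℂ)ᴴ) 1 ^ 2 + vecQuat (quatVec J * ((U : Matrix.specialUnitaryGroup (Fin 2) ℂ) : Matrix (Fin 2) (Fin 2) ℂ)ᴴ) 2 ^ 2 + vecQuat (quatVec J * ((U : Matrix.specialUnitaryGroup (Fin 2) ℂ) : Matrix (Fin 2) (Fin 2) ℂ)ᴴ) 3 ^ 2)) * vecQuat (quatVec J * ((U : Matrix.specialUnitaryGroup (Fin 2) ℂ) : Matrix (Fin 2) (Fin 2) ℂ)ᴴ) 2, c * sinc (c * √(vecQuat (quatVec J * ((U : Matrix.specialUnitaryGroup (Fin 2) ℂ) : Matrix (Fin 2) (Fin 2) ℂ)ᴴ) 1 ^ 2 + vecQuat (quatVec J * ((U : Matrix.specialUnitaryGroup (Fin 2) ℂ) : Matrix (Fin 2) (Fin 2) ℂ)ᴴ) 2 ^ 2 + vecQuat (quatVec J * ((U : Matrix.specialUnitaryGroup (Fin 2) ℂ) : Matrix (Fin 2) (Fin 2) ℂ)ᴴ)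 3 ^ 2)) * vecQuat (quatVec J * ((U : Matrix.specialUnitaryGroup (Fin 2) ℂ) : Matrix (Fin 2) (Fin 2) ℂ)ᴴ) 3] : R4) : Matrix.specialUnitaryGroup (Fin 2) ℂ) : Matrix (Fin 2) (Fin 2) ℂ) := by
  set x : R4 := vecQuat (quatVec J * ((U : Matrix.specialUnitaryGroup (Fin 2) ℂ) : Matrix (Fin 2) (Fin 2) ℂ)ᴴ) with hx
  have hq : quatVec x = quatVec J * (U : Matrix (Fin 2) (Fin 2) ℂ)ᴴ := by
    rw [hx, ← WilsonFlow.coe_inv_SU]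
    exact quatVec_vecQuat ((isQuat_quatVec J).mul (IsQuat.of_mem_specialUnitaryGroup (U⁻¹).2))
  have h1 : (toLp 2 ![0, c * x 1, c * x 2, c * x 3] : R4) = c • toLp 2 ![0, x 1, x 2, x 3] := by
    ext i
    fin_cases i <;> simp
  rw [coe_gaussUnit_closedForm_eq_exp, h1, quatVec_smul, quatVec_im_eq_half_sub_conjTranspose, hq, smul_smul]
  congr 2
  push_cast
  ring

/-- Hence the quaternion coordinates of the left factor: `vecQuat (F(U) U⁻¹) = closed form at
`Im (Q_J Uᴴ)`. -/
theorem vecQuat_kick_mul_inv :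
    vecQuat ((gaussUnit (geodesicKick c J (vecQuat ((U : Matrix.specialUnitaryGroup (Fin 2) ℂ) : Matrix (Fin 2) (Fin 2) ℂ))) * U⁻¹ : Matrix.specialUnitaryGroup (Fin 2) ℂ) : Matrix (Fin 2) (Fin 2) ℂ) =
      (toLp 2 ![Real.cos (c * √(vecQuat (quatVec J * ((U : Matrix.specialUnitaryGroup (Fin 2) ℂ) : Matrix (Fin 2) (Fin 2) ℂ)ᴴ) 1 ^ 2 + vecQuat (quatVec J * ((U : Matrix.specialUnitaryGroup (Fin 2) ℂ) : Matrix (Fin 2) (Fin 2) ℂ)ᴴ) 2 ^ 2 + vecQuat (quatVec J * ((U : Matrix.specialUnitaryGroup (Fin 2) ℂ) : Matrix (Fin 2) (Fin 2) ℂ)ᴴ) 3 ^ 2)), c * sinc (c * √(vecQuat (quatVec J * ((U : Matrix.specialUnitaryGroup (Fin 2) ℂ) : Matrix (Fin 2) (Fin 2) ℂ)ᴴ) 1 ^ 2 + vecQuat (quatVec J * ((U : Matrix.specialUnitaryGroup (Fin 2) ℂ) : Matrix (Fin 2) (Fin 2) ℂ)ᴴ) 2 ^ 2 + vecQuat (quatVec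 J * ((U : Matrix.specialUnitaryGroup (Fin 2) ℂ) : Matrix (Fin 2) (Fin 2) ℂ)ᴴ) 3 ^ 2)) * vecQuat (quatVec J * ((U : Matrix.specialUnitaryGroup (Fin 2) ℂ) : Matrix (Fin 2) (Fin 2) ℂ)ᴴ) 1, c * sinc (c * √(vecQuat (quatVec J * ((U : Matrix.specialUnitaryGroup (Fin 2) ℂ) : Matrix (Fin 2) (Fin 2) ℂ)ᴴ) 1 ^ 2 + vecQuat (quatVec J * ((U : Matrix.specialUnitaryGroup (Fin 2) ℂ) : Matrix (Fin 2) (Fin 2) ℂ)ᴴ) 2 ^ 2 + vecQuat (quatVec J * ((U : Matrix.specialUnitaryGroup (Fin 2) ℂ) : Matrix (Fin 2) (Fin 2) ℂ)ᴴ) 3 ^ 2)) * vecQuat (quatVec J * ((U : Matrix.specialUnitaryGroup (Fin 2) ℂ) : Matrix (Fin 2) (Fin 2) ℂ)ᴴ) 2, c * sinc (c * √(vecQuat (quatVec J * ((U : Matrix.specialUnitaryGroup (Fin 2) ℂ) : Matrix (Fin 2) (Fin 2) ℂ)ᴴ) 1 ^ 2 + vecQuat (quatVec J * ((U : Matrix.specialUnitaryGroup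 (Fin 2) ℂ) : Matrix (Fin 2) (Fin 2) ℂ)ᴴ) 2 ^ 2 + vecQuat (quatVec J * ((U : Matrix.specialUnitaryGroup (Fin 2) ℂ) : Matrix (Fin 2) (Fin 2) ℂ)ᴴ) 3 ^ 2)) * vecQuat (quatVec J * ((U : Matrix.specialUnitaryGroup (Fin 2) ℂ) : Matrix (Fin 2) (Fin 2) ℂ)ᴴ) 3] : R4) := by
  have hv1 := norm_closedForm_eq_one c (vecQuat (quatVec J * ((U : Matrix.specialUnitaryGroup (Fin 2) ℂ) : Matrix (Fin 2) (Fin 2) ℂ)ᴴ) 1) (vecQuat (quatVec J * ((U : Matrix.specialUnitaryGroup (Fin 2) ℂ) : Matrix (Fin 2) (Fin 2) ℂ)ᴴ) 2) (vecQuat (quatVec J * ((U : Matrix.specialUnitaryGroup (Fin 2) ℂ) : Matrix (Fin 2) (Fin 2) ℂ)ᴴ) 3)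
  have hv0 : (toLp 2 ![Real.cos (c * √(vecQuat (quatVec J * ((U : Matrix.specialUnitaryGroup (Fin 2) ℂ) : Matrix (Fin 2) (Fin 2) ℂ)ᴴ) 1 ^ 2 + vecQuat (quatVec J * ((U : Matrix.specialUnitaryGroup (Fin 2) ℂ) : Matrix (Fin 2) (Fin 2) ℂ)ᴴ) 2 ^ 2 + vecQuat (quatVec J * ((U : Matrix.specialUnitaryGroup (Fin 2) ℂ) : Matrix (Fin 2) (Fin 2) ℂ)ᴴ) 3 ^ 2)), c * sinc (c * √(vecQuat (quatVec J * ((U : Matrix.specialUnitaryGroup (Fin 2) ℂ) : Matrix (Fin 2) (Fin 2) ℂ)ᴴ) 1 ^ 2 + vecQuat (quatVec J * ((U : Matrix.specialUnitaryGroup (Fin 2) ℂ) : Matrix (Fin 2) (Fin 2) ℂ)ᴴ) 2 ^ 2 + vecQuat (quatVec J * ((U : Matrix.specialUnitaryGroup (Fin 2) ℂ) : Matrix (Fin 2) (Fin 2) ℂ)ᴴ) 3 ^ 2)) * vecQuat (quatVec J * ((U : Matrix.specialUnitaryGroup (Fin 2) ℂ) : Matrix (Fin 2) (Fin 2) ℂ)ᴴ)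 1, c * sinc (c * √(vecQuat (quatVec J * ((U : Matrix.specialUnitaryGroup (Fin 2) ℂ) : Matrix (Fin 2) (Fin 2) ℂ)ᴴ) 1 ^ 2 + vecQuat (quatVec J * ((U : Matrix.specialUnitaryGroup (Fin 2) ℂ) : Matrix (Fin 2) (Fin 2) ℂ)ᴴ) 2 ^ 2 + vecQuat (quatVec J * ((U : Matrix.specialUnitaryGroup (Fin 2) ℂ) : Matrix (Fin 2) (Fin 2) ℂ)ᴴ) 3 ^ 2)) * vecQuat (quatVec J * ((U : Matrix.specialUnitaryGroup (Fin 2) ℂ) : Matrix (Fin 2) (Fin 2) ℂ)ᴴ) 2, c * sinc (c * √(vecQuat (quatVec J * ((U : Matrix.specialUnitaryGroup (Fin 2) ℂ) : Matrix (Fin 2) (Fin 2) ℂ)ᴴ) 1 ^ 2 + vecQuat (quatVec J * ((U : Matrix.specialUnitaryGroup (Fin 2) ℂ) : Matrix (Fin 2) (Fin 2) ℂ)ᴴ) 2 ^ 2 + vecQuat (quatVec J * ((U : Matrix.specialUnitaryGroup (Fin 2) ℂ) : Matrix (Fin 2) (Fin 2) ℂ)ᴴ) 3 ^ 2)) * vecQuat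 (quatVec J * ((U : Matrix.specialUnitaryGroup (Fin 2) ℂ) : Matrix (Fin 2) (Fin 2) ℂ)ᴴ) 3] : R4) ≠ 0 := fun h => by
    rw [h, norm_zero] at hv1
    exact zero_ne_one hv1
  rw [coe_kick_mul_inv_eq_exp, exp_skew_eq_coe_gaussUnit_closedForm, coe_gaussUnit_of_ne_zero hv0, hv1, inv_one,
    one_smul, vecQuat_quatVec]

/-- `x(U) = vecQuat (Q_J Uᴴ)` is `‖J‖`-Lipschitz — in fact `‖x(U₁) − x(U₂)‖ = ‖J‖ ‖U₁ − U₂‖`. -/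
theorem norm_vecQuat_mul_conjTranspose_sub (U₁ U₂ : Matrix.specialUnitaryGroup (Fin 2) ℂ) :
    ‖vecQuat (quatVec J * ((U₁ : Matrix.specialUnitaryGroup (Fin 2) ℂ) : Matrix (Fin 2) (Fin 2) ℂ)ᴴ) - vecQuat (quatVec J * ((U₂ : Matrix.specialUnitaryGroup (Fin 2) ℂ) : Matrix (Fin 2) (Fin 2) ℂ)ᴴ)‖ =
      ‖J‖ * ‖vecQuat ((U₁ : Matrix.specialUnitaryGroup (Fin 2) ℂ) : Matrix (Fin 2) (Fin 2) ℂ) - vecQuat ((U₂ : Matrix.specialUnitaryGroup (Fin 2) ℂ) : Matrix (Fin 2) (Fin 2) ℂ)‖ := by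
  have hd : IsQuat (((U₁ : Matrix.specialUnitaryGroup (Fin 2) ℂ) : Matrix (Fin 2) (Fin 2) ℂ) - ((U₂ : Matrix.specialUnitaryGroup (Fin 2) ℂ) : Matrix (Fin 2) (Fin 2) ℂ)) :=
    isQuat_sub (IsQuat.of_mem_specialUnitaryGroup U₁.2) (IsQuat.of_mem_specialUnitaryGroup U₂.2)
  rw [← vecQuat_sub, ← Matrix.mul_sub, ← Matrix.conjTranspose_sub, norm_vecQuat_mul (isQuat_quatVec J) hd.conjTranspose,
    norm_vecQuat_conjTranspose hd, vecQuat_quatVec, vecQuat_sub]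

end LeftFactor

/-! ## The engine's fixed-point map and its contraction -/

section FixedPoint

variable (c : ℝ) (J : R4)

/-- **The typed fixed-point map IS the engine's**: `U · F(U)⁻¹ · U' = exp(−X(U)) · U'`
(`maps.wflow_substep_inverse_flat`: `U ← expm(-Q_of(U)) @ U_out`, `Q_of(U) = X(U)` by
`coe_su2Substep_eq_exp_mul`). -/
theorem coe_su2FixedPointMap_eq_exp_neg_mul (U U' : Matrix.specialUnitaryGroup (Fin 2) ℂ) :
    ((U * (gaussUnit (geodesicKick c J (vecQuat ((U : Matrix.specialUnitaryGroup (Fin 2) ℂ) : Matrix (Fin 2) (Fin 2) ℂ))))⁻¹ * U' : Matrix.specialUnitaryGroup (Fin 2) ℂ) : Matrix (Fin 2) (Fin 2) ℂ) =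
      exp (-((((c / 2 : ℝ)) : ℂ) • (quatVec J * (U : Matrix (Fin 2) (Fin 2) ℂ)ᴴ - (quatVec J * (U : Matrix (Fin 2) (Fin 2) ℂ)ᴴ)ᴴ))) * (U' : Matrix (Fin 2) (Fin 2) ℂ) := by
  have hgrp : U * (gaussUnit (geodesicKick c J (vecQuat ((U : Matrix.specialUnitaryGroup (Fin 2) ℂ) : Matrix (Fin 2) (Fin 2) ℂ))))⁻¹ * U' = (gaussUnit (geodesicKick c J (vecQuat ((U : Matrix.specialUnitaryGroup (Fin 2) ℂ) : Matrix (Fin 2) (Fin 2) ℂ))) * U⁻¹)⁻¹ * U' := by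
    rw [mul_inv_rev, inv_inv]
  have hX : ((((c / 2 : ℝ)) : ℂ) • (quatVec J * (U : Matrix (Fin 2) (Fin 2) ℂ)ᴴ - (quatVec J * (U : Matrix (Fin 2) (Fin 2) ℂ)ᴴ)ᴴ))ᴴ =
      -((((c / 2 : ℝ)) : ℂ) • (quatVec J * (U : Matrix (Fin 2) (Fin 2) ℂ)ᴴ - (quatVec J * (U : Matrix (Fin 2) (Fin 2) ℂ)ᴴ)ᴴ)) := by
    rw [Matrix.conjTranspose_smul, Matrix.conjTranspose_sub, Matrix.conjTranspose_conjTranspose, Complex.star_def,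
      Complex.conj_ofReal, ← smul_neg, neg_sub]
  rw [hgrp, WilsonFlow.coe_mul_SU, WilsonFlow.coe_inv_SU, coe_kick_mul_inv_eq_exp, ← Matrix.exp_conjTranspose, hX]

/-- **The fixed-point map is `κ`-Lipschitz, `κ = |c|‖J‖`** (quaternion coordinates): for all
`U₁, U₂, U' ∈ SU(2)`, `‖T U₁ − T U₂‖ ≤ |c| ‖J‖ ‖U₁ − U₂‖`, `T(U) = U · F(U)⁻¹ · U'`.  Inside the
layer's refusal rule `κ < 1` the engine's iteration is a contraction of the compact `SU(2)`. -/
theorem su2FixedPointMap_lipschitz (U' U₁ U₂ : Matrix.specialUnitaryGroup (Fin 2) ℂ) :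
    ‖vecQuat ((U₁ * (gaussUnit (geodesicKick c J (vecQuat ((U₁ : Matrix.specialUnitaryGroup (Fin 2) ℂ) : Matrix (Fin 2) (Fin 2) ℂ))))⁻¹ * U' : Matrix.specialUnitaryGroup (Fin 2) ℂ) : Matrix (Fin 2) (Fin 2) ℂ) -
        vecQuat ((U₂ * (gaussUnit (geodesicKick c J (vecQuat ((U₂ : Matrix.specialUnitaryGroup (Fin 2) ℂ) : Matrix (Fin 2) (Fin 2) ℂ))))⁻¹ * U' : Matrix.specialUnitaryGroup (Fin 2) ℂ) : Matrix (Fin 2) (Fin 2) ℂ)‖ ≤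
      |c| * ‖J‖ * ‖vecQuat ((U₁ : Matrix.specialUnitaryGroup (Fin 2) ℂ) : Matrix (Fin 2) (Fin 2) ℂ) - vecQuat ((U₂ : Matrix.specialUnitaryGroup (Fin 2) ℂ) : Matrix (Fin 2) (Fin 2) ℂ)‖ := by
  -- rewrite `U F(U)⁻¹ U' = (F(U) U⁻¹)ᴴ U'` as matrices
  have hgrp : ∀ U : Matrix.specialUnitaryGroup (Fin 2) ℂ,
      ((U * (gaussUnit (geodesicKick c J (vecQuat ((U : Matrix.specialUnitaryGroup (Fin 2) ℂ) : Matrix (Fin 2) (Fin 2) ℂ))))⁻¹ * U' : Matrix.specialUnitaryGroup (Fin 2) ℂ) : Matrix (Fin 2) (Fin 2) ℂ) =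
        (((gaussUnit (geodesicKick c J (vecQuat ((U : Matrix.specialUnitaryGroup (Fin 2) ℂ) : Matrix (Fin 2) (Fin 2) ℂ))) * U⁻¹ : Matrix.specialUnitaryGroup (Fin 2) ℂ) : Matrix (Fin 2) (Fin 2) ℂ))ᴴ * (U' : Matrix (Fin 2) (Fin 2) ℂ) := by
    intro U
    rw [show U * (gaussUnit (geodesicKick c J (vecQuat ((U : Matrix.specialUnitaryGroup (Fin 2) ℂ) : Matrix (Fin 2) (Fin 2) ℂ))))⁻¹ * U' = (gaussUnit (geodesicKick c J (vecQuat ((U : Matrix.specialUnitaryGroup (Fin 2) ℂ) : Matrix (Fin 2) (Fin 2) ℂ))) * U⁻¹)⁻¹ * U' by rw [mul_inv_rev, inv_inv],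
      WilsonFlow.coe_mul_SU, WilsonFlow.coe_inv_SU]
  set E₁ : Matrix.specialUnitaryGroup (Fin 2) ℂ := gaussUnit (geodesicKick c J (vecQuat ((U₁ : Matrix.specialUnitaryGroup (Fin 2) ℂ) : Matrix (Fin 2) (Fin 2) ℂ))) * U₁⁻¹ with hE₁
  set E₂ : Matrix.specialUnitaryGroup (Fin 2) ℂ := gaussUnit (geodesicKick c J (vecQuat ((U₂ : Matrix.specialUnitaryGroup (Fin 2) ℂ) : Matrix (Fin 2) (Fin 2) ℂ))) * U₂⁻¹ with hE₂
  have hq₁ : IsQuat ((E₁ : Matrix.specialUnitaryGroup (Fin 2) ℂ) : Matrix (Fin 2) (Fin 2) ℂ) := IsQuat.of_mem_specialUnitaryGroup E₁.2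
  have hq₂ : IsQuat ((E₂ : Matrix.specialUnitaryGroup (Fin 2) ℂ) : Matrix (Fin 2) (Fin 2) ℂ) := IsQuat.of_mem_specialUnitaryGroup E₂.2
  have hd : IsQuat (((E₁ : Matrix.specialUnitaryGroup (Fin 2) ℂ) : Matrix (Fin 2) (Fin 2) ℂ) - ((E₂ : Matrix.specialUnitaryGroup (Fin 2) ℂ) : Matrix (Fin 2) (Fin 2) ℂ)) := isQuat_sub hq₁ hq₂
  rw [hgrp U₁, hgrp U₂, ← vecQuat_sub, ← Matrix.sub_mul, ← Matrix.conjTranspose_sub,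
    norm_vecQuat_mul hd.conjTranspose (IsQuat.of_mem_specialUnitaryGroup U'.2), norm_vecQuat_of_mem, mul_one,
    norm_vecQuat_conjTranspose hd, vecQuat_sub, hE₁, hE₂, vecQuat_kick_mul_inv, vecQuat_kick_mul_inv]
  calc ‖(toLp 2 ![Real.cos (c * √(vecQuat (quatVec J * ((U₁ : Matrix.specialUnitaryGroup (Fin 2) ℂ) : Matrix (Fin 2) (Fin 2) ℂ)ᴴ) 1 ^ 2 + vecQuat (quatVec J * ((U₁ : Matrix.specialUnitaryGroup (Fin 2) ℂ) : Matrix (Fin 2) (Fin 2) ℂ)ᴴ) 2 ^ 2 + vecQuat (quatVec J * ((U₁ : Matrix.specialUnitaryGroup (Fin 2) ℂ) : Matrix (Fin 2) (Fin 2) ℂ)ᴴ) 3 ^ 2)), c * sinc (c * √(vecQuat (quatVec J * ((U₁ : Matrix.specialUnitaryGroup (Fin 2) ℂ) : Matrix (Fin 2) (Fin 2) ℂ)ᴴ) 1 ^ 2 + vecQuat (quatVec J * ((U₁ : Matrix.specialUnitaryGroup (Fin 2) ℂ) : Matrix (Fin 2) (Fin 2) ℂ)ᴴ) 2 ^ 2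 + vecQuat (quatVec J * ((U₁ : Matrix.specialUnitaryGroup (Fin 2) ℂ) : Matrix (Fin 2) (Fin 2) ℂ)ᴴ) 3 ^ 2)) * vecQuat (quatVec J * ((U₁ : Matrix.specialUnitaryGroup (Fin 2) ℂ) : Matrix (Fin 2) (Fin 2) ℂ)ᴴ) 1, c * sinc (c * √(vecQuat (quatVec J * ((U₁ : Matrix.specialUnitaryGroup (Fin 2) ℂ) : Matrix (Fin 2) (Fin 2) ℂ)ᴴ) 1 ^ 2 + vecQuat (quatVec J * ((U₁ : Matrix.specialUnitaryGroup (Fin 2) ℂ) : Matrix (Fin 2) (Fin 2) ℂ)ᴴ) 2 ^ 2 + vecQuat (quatVec J * ((U₁ : Matrix.specialUnitaryGroup (Fin 2) ℂ) : Matrix (Fin 2) (Fin 2) ℂ)ᴴ) 3 ^ 2)) * vecQuat (quatVec J * ((U₁ : Matrix.specialUnitaryGroup (Fin 2) ℂ) : Matrix (Fin 2) (Fin 2) ℂ)ᴴ) 2, c * sinc (c * √(vecQuat (quatVec J * ((U₁ : Matrix.specialUnitaryGroup (Fin 2) ℂ) : Matrix (Fin 2) (Fin 2) ℂ)ᴴ)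 1 ^ 2 + vecQuat (quatVec J * ((U₁ : Matrix.specialUnitaryGroup (Fin 2) ℂ) : Matrix (Fin 2) (Fin 2) ℂ)ᴴ) 2 ^ 2 + vecQuat (quatVec J * ((U₁ : Matrix.specialUnitaryGroup (Fin 2) ℂ) : Matrix (Fin 2) (Fin 2) ℂ)ᴴ) 3 ^ 2)) * vecQuat (quatVec J * ((U₁ : Matrix.specialUnitaryGroup (Fin 2) ℂ) : Matrix (Fin 2) (Fin 2) ℂ)ᴴ) 3] : R4) -
          (toLp 2 ![Real.cos (c * √(vecQuat (quatVec J * ((U₂ : Matrix.specialUnitaryGroup (Fin 2) ℂ) : Matrix (Fin 2) (Fin 2) ℂ)ᴴ) 1 ^ 2 + vecQuat (quatVec J * ((U₂ : Matrix.specialUnitaryGroup (Fin 2) ℂ) : Matrix (Fin 2) (Fin 2) ℂ)ᴴ) 2 ^ 2 + vecQuat (quatVec J * ((U₂ : Matrix.specialUnitaryGroup (Fin 2) ℂ) : Matrix (Fin 2) (Fin 2) ℂ)ᴴ) 3 ^ 2)), c * sinc (c * √(vecQuat (quatVec J * ((U₂ : Matrix.specialUnitaryGroup (Fin 2) ℂ)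 : Matrix (Fin 2) (Fin 2) ℂ)ᴴ) 1 ^ 2 + vecQuat (quatVec J * ((U₂ : Matrix.specialUnitaryGroup (Fin 2) ℂ) : Matrix (Fin 2) (Fin 2) ℂ)ᴴ) 2 ^ 2 + vecQuat (quatVec J * ((U₂ : Matrix.specialUnitaryGroup (Fin 2) ℂ) : Matrix (Fin 2) (Fin 2) ℂ)ᴴ) 3 ^ 2)) * vecQuat (quatVec J * ((U₂ : Matrix.specialUnitaryGroup (Fin 2) ℂ) : Matrix (Fin 2) (Fin 2) ℂ)ᴴ) 1, c * sinc (c * √(vecQuat (quatVec J * ((U₂ : Matrix.specialUnitaryGroup (Fin 2) ℂ) : Matrix (Fin 2) (Fin 2) ℂ)ᴴ) 1 ^ 2 + vecQuat (quatVec J * ((U₂ : Matrix.specialUnitaryGroup (Fin 2) ℂ) : Matrix (Fin 2) (Fin 2) ℂ)ᴴ) 2 ^ 2 + vecQuat (quatVec J * ((U₂ : Matrix.specialUnitaryGroup (Fin 2) ℂ) : Matrix (Fin 2) (Fin 2) ℂ)ᴴ) 3 ^ 2)) * vecQuat (quatVec J * ((U₂ : Matrix.specialUnitaryGroup (Fin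 2) ℂ) : Matrix (Fin 2) (Fin 2) ℂ)ᴴ) 2, c * sinc (c * √(vecQuat (quatVec J * ((U₂ : Matrix.specialUnitaryGroup (Fin 2) ℂ) : Matrix (Fin 2) (Fin 2) ℂ)ᴴ) 1 ^ 2 + vecQuat (quatVec J * ((U₂ : Matrix.specialUnitaryGroup (Fin 2) ℂ) : Matrix (Fin 2) (Fin 2) ℂ)ᴴ) 2 ^ 2 + vecQuat (quatVec J * ((U₂ : Matrix.specialUnitaryGroup (Fin 2) ℂ) : Matrix (Fin 2) (Fin 2) ℂ)ᴴ) 3 ^ 2)) * vecQuat (quatVec J * ((U₂ : Matrix.specialUnitaryGroup (Fin 2) ℂ) : Matrix (Fin 2) (Fin 2) ℂ)ᴴ) 3] : R4)‖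
      ≤ |c| * √((vecQuat (quatVec J * ((U₁ : Matrix.specialUnitaryGroup (Fin 2) ℂ) : Matrix (Fin 2) (Fin 2) ℂ)ᴴ) 1 - vecQuat (quatVec J * ((U₂ : Matrix.specialUnitaryGroup (Fin 2) ℂ) : Matrix (Fin 2) (Fin 2) ℂ)ᴴ) 1) ^ 2 + (vecQuat (quatVec J * ((U₁ : Matrix.specialUnitaryGroup (Fin 2) ℂ) : Matrix (Fin 2) (Fin 2) ℂ)ᴴ) 2 - vecQuat (quatVec J * ((U₂ : Matrix.specialUnitaryGroup (Fin 2) ℂ) : Matrix (Fin 2) (Fin 2) ℂ)ᴴ) 2) ^ 2 +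
          (vecQuat (quatVec J * ((U₁ : Matrix.specialUnitaryGroup (Fin 2) ℂ) : Matrix (Fin 2) (Fin 2) ℂ)ᴴ) 3 - vecQuat (quatVec J * ((U₂ : Matrix.specialUnitaryGroup (Fin 2) ℂ) : Matrix (Fin 2) (Fin 2) ℂ)ᴴ) 3) ^ 2) := norm_closedForm_sub_closedForm_le _ _ _ _ _ _ _
    _ ≤ |c| * ‖vecQuat (quatVec J * ((U₁ : Matrix.specialUnitaryGroup (Fin 2) ℂ) : Matrix (Fin 2) (Fin 2) ℂ)ᴴ) - vecQuat (quatVec J * ((U₂ : Matrix.specialUnitaryGroup (Fin 2) ℂ) : Matrix (Fin 2) (Fin 2) ℂ)ᴴ)‖ := by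
        refine mul_le_mul_of_nonneg_left ?_ (abs_nonneg c)
        have h := sqrt_imSq_le_norm (vecQuat (quatVec J * ((U₁ : Matrix.specialUnitaryGroup (Fin 2) ℂ) : Matrix (Fin 2) (Fin 2) ℂ)ᴴ) - vecQuat (quatVec J * ((U₂ : Matrix.specialUnitaryGroup (Fin 2) ℂ) : Matrix (Fin 2) (Fin 2) ℂ)ᴴ))
        simpa only [PiLp.sub_apply] using h
    _ = |c| * ‖J‖ * ‖vecQuat ((U₁ : Matrix.specialUnitaryGroup (Fin 2) ℂ) : Matrix (Fin 2) (Fin 2) ℂ) - vecQuat ((U₂ : Matrix.specialUnitaryGroup (Fin 2) ℂ) : Matrix (Fin 2) (Fin 2) ℂ)‖ := by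
        rw [norm_vecQuat_mul_conjTranspose_sub, mul_assoc]

/-- `T U = U ↔ F U = U'`: the fixed points of the engine's map are exactly the preimages of the
target. -/
theorem su2FixedPointMap_eq_self_iff (U U' : Matrix.specialUnitaryGroup (Fin 2) ℂ) :
    U * (gaussUnit (geodesicKick c J (vecQuat ((U : Matrix.specialUnitaryGroup (Fin 2) ℂ) : Matrix (Fin 2) (Fin 2) ℂ))))⁻¹ * U' = U ↔ gaussUnit (geodesicKick c J (vecQuat ((U : Matrix.specialUnitaryGroup (Fin 2) ℂ) : Matrix (Fin 2) (Fin 2) ℂ))) = U' := by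
  constructor
  · intro h
    have h1 : U * ((gaussUnit (geodesicKick c J (vecQuat ((U : Matrix.specialUnitaryGroup (Fin 2) ℂ) : Matrix (Fin 2) (Fin 2) ℂ))))⁻¹ * U') = U * 1 := by rwa [← mul_assoc, mul_one]
    exact inv_mul_eq_one.mp (mul_left_cancel h1)
  · intro h
    rw [← h, mul_assoc, inv_mul_cancel, mul_one]

/-- **Geometric convergence to a preimage**: if `F U⋆ = U'` then for every start `U₀` and every
`n`, `‖T^[n] U₀ − U⋆‖ ≤ (|c|‖J‖)ⁿ ‖U₀ − U⋆‖` (quaternion coordinates). -/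
theorem su2FixedPoint_iterate_le (U' Ustar U₀ : Matrix.specialUnitaryGroup (Fin 2) ℂ)
    (hstar : gaussUnit (geodesicKick c J (vecQuat ((Ustar : Matrix.specialUnitaryGroup (Fin 2) ℂ) : Matrix (Fin 2) (Fin 2) ℂ))) = U') (n : ℕ) :
    ‖vecQuat (((fun U : Matrix.specialUnitaryGroup (Fin 2) ℂ => U * (gaussUnit (geodesicKick c J (vecQuat ((U : Matrix.specialUnitaryGroup (Fin 2) ℂ) : Matrix (Fin 2) (Fin 2) ℂ))))⁻¹ * U')^[n] U₀ : Matrix.specialUnitaryGroup (Fin 2) ℂ) : Matrix (Fin 2) (Fin 2) ℂ) -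
        vecQuat ((Ustar : Matrix.specialUnitaryGroup (Fin 2) ℂ) : Matrix (Fin 2) (Fin 2) ℂ)‖ ≤
      (|c| * ‖J‖) ^ n * ‖vecQuat ((U₀ : Matrix.specialUnitaryGroup (Fin 2) ℂ) : Matrix (Fin 2) (Fin 2) ℂ) - vecQuat ((Ustar : Matrix.specialUnitaryGroup (Fin 2) ℂ) : Matrix (Fin 2) (Fin 2) ℂ)‖ := by
  induction n with
  | zero => simp
  | succ n ih =>
    have hfix : Ustar * (gaussUnit (geodesicKick c J (vecQuat ((Ustar : Matrix.specialUnitaryGroup (Fin 2) ℂ) : Matrix (Fin 2) (Fin 2) ℂ))))⁻¹ * U' = Ustar := (su2FixedPointMap_eq_self_iff c J Ustar U').2 hstar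
    rw [Function.iterate_succ_apply', pow_succ]
    calc ‖vecQuat ((((fun U : Matrix.specialUnitaryGroup (Fin 2) ℂ => U * (gaussUnit (geodesicKick c J (vecQuat ((U : Matrix.specialUnitaryGroup (Fin 2) ℂ) : Matrix (Fin 2) (Fin 2) ℂ))))⁻¹ * U')^[n] U₀) *
            (gaussUnit (geodesicKick c J (vecQuat ((((fun U : Matrix.specialUnitaryGroup (Fin 2) ℂ => U * (gaussUnit (geodesicKick c J (vecQuat ((U : Matrix.specialUnitaryGroup (Fin 2) ℂ) : Matrix (Fin 2) (Fin 2) ℂ))))⁻¹ * U')^[n] U₀) : Matrix.specialUnitaryGroup (Fin 2) ℂ) : Matrix (Fin 2) (Fin 2) ℂ))))⁻¹ * U' : Matrix.specialUnitaryGroup (Fin 2) ℂ) : Matrix (Fin 2) (Fin 2) ℂ) -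
          vecQuat ((Ustar : Matrix.specialUnitaryGroup (Fin 2) ℂ) : Matrix (Fin 2) (Fin 2) ℂ)‖
        = ‖vecQuat ((((fun U : Matrix.specialUnitaryGroup (Fin 2) ℂ => U * (gaussUnit (geodesicKick c J (vecQuat ((U : Matrix.specialUnitaryGroup (Fin 2) ℂ) : Matrix (Fin 2) (Fin 2) ℂ))))⁻¹ * U')^[n] U₀) *
            (gaussUnit (geodesicKick c J (vecQuat ((((fun U : Matrix.specialUnitaryGroup (Fin 2) ℂ => U * (gaussUnit (geodesicKick c J (vecQuat ((U : Matrix.specialUnitaryGroup (Fin 2) ℂ) : Matrix (Fin 2) (Fin 2) ℂ))))⁻¹ * U')^[n] U₀) : Matrix.specialUnitaryGroup (Fin 2) ℂ) : Matrix (Fin 2) (Fin 2) ℂ))))⁻¹ * U' : Matrix.specialUnitaryGroup (Fin 2) ℂ) : Matrix (Fin 2) (Fin 2) ℂ) -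
          vecQuat ((Ustar * (gaussUnit (geodesicKick c J (vecQuat ((Ustar : Matrix.specialUnitaryGroup (Fin 2) ℂ) : Matrix (Fin 2) (Fin 2) ℂ))))⁻¹ * U' : Matrix.specialUnitaryGroup (Fin 2) ℂ) : Matrix (Fin 2) (Fin 2) ℂ)‖ := by rw [hfix]
      _ ≤ |c| * ‖J‖ * ‖vecQuat ((((fun U : Matrix.specialUnitaryGroup (Fin 2) ℂ => U * (gaussUnit (geodesicKick c J (vecQuat ((U : Matrix.specialUnitaryGroup (Fin 2) ℂ) : Matrix (Fin 2) (Fin 2) ℂ))))⁻¹ * U')^[n] U₀ : Matrix.specialUnitaryGroup (Fin 2) ℂ) : Matrix (Fin 2) (Fin 2) ℂ)) -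
          vecQuat ((Ustar : Matrix.specialUnitaryGroup (Fin 2) ℂ) : Matrix (Fin 2) (Fin 2) ℂ)‖ := su2FixedPointMap_lipschitz c J U' _ _
      _ ≤ |c| * ‖J‖ * ((|c| * ‖J‖) ^ n * ‖vecQuat ((U₀ : Matrix.specialUnitaryGroup (Fin 2) ℂ) : Matrix (Fin 2) (Fin 2) ℂ) - vecQuat ((Ustar : Matrix.specialUnitaryGroup (Fin 2) ℂ) : Matrix (Fin 2) (Fin 2) ℂ)‖) :=
          mul_le_mul_of_nonneg_left ih (mul_nonneg (abs_nonneg c) (norm_nonneg J))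
      _ = (|c| * ‖J‖) ^ n * (|c| * ‖J‖) * ‖vecQuat ((U₀ : Matrix.specialUnitaryGroup (Fin 2) ℂ) : Matrix (Fin 2) (Fin 2) ℂ) - vecQuat ((Ustar : Matrix.specialUnitaryGroup (Fin 2) ℂ) : Matrix (Fin 2) (Fin 2) ℂ)‖ := by
          ring

/-- **The engine's inverse converges, from any start, to THE preimage** (`|c|‖J‖ ≤ 1`, the range
of `bijective_su2Kick`): there is a unique `U⋆` with `F U⋆ = U'`, and
`‖T^[n] U₀ − U⋆‖ ≤ 2 (|c|‖J‖)ⁿ` for all `n` and `U₀` (the engine starts at `U₀ = U'` and runs a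
fixed `n_iter`; for `κ < 1` the bound is geometric). -/
theorem su2FixedPoint_converges (hc : |c| * ‖J‖ ≤ 1) (U' U₀ : Matrix.specialUnitaryGroup (Fin 2) ℂ) :
    ∃ Ustar : Matrix.specialUnitaryGroup (Fin 2) ℂ, gaussUnit (geodesicKick c J (vecQuat ((Ustar : Matrix.specialUnitaryGroup (Fin 2) ℂ) : Matrix (Fin 2) (Fin 2) ℂ))) = U' ∧
      (∀ V : Matrix.specialUnitaryGroup (Fin 2) ℂ, gaussUnit (geodesicKick c J (vecQuat ((V : Matrix.specialUnitaryGroup (Fin 2) ℂ) : Matrix (Fin 2) (Fin 2) ℂ))) = U' → V = Ustar) ∧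
      ∀ n : ℕ, ‖vecQuat (((fun U : Matrix.specialUnitaryGroup (Fin 2) ℂ => U * (gaussUnit (geodesicKick c J (vecQuat ((U : Matrix.specialUnitaryGroup (Fin 2) ℂ) : Matrix (Fin 2) (Fin 2) ℂ))))⁻¹ * U')^[n] U₀ : Matrix.specialUnitaryGroup (Fin 2) ℂ) : Matrix (Fin 2) (Fin 2) ℂ) -
          vecQuat ((Ustar : Matrix.specialUnitaryGroup (Fin 2) ℂ) : Matrix (Fin 2) (Fin 2) ℂ)‖ ≤ 2 * (|c| * ‖J‖) ^ n := by
  obtain ⟨Ustar, hstar⟩ := (bijective_su2Kick hc).2 U'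
  refine ⟨Ustar, hstar, fun V hV => (bijective_su2Kick hc).1 (hV.trans hstar.symm), fun n => ?_⟩
  have h2 : ‖vecQuat ((U₀ : Matrix.specialUnitaryGroup (Fin 2) ℂ) : Matrix (Fin 2) (Fin 2) ℂ) - vecQuat ((Ustar : Matrix.specialUnitaryGroup (Fin 2) ℂ) : Matrix (Fin 2) (Fin 2) ℂ)‖ ≤ 2 :=
    (norm_sub_le _ _).trans (by rw [norm_vecQuat_of_mem, norm_vecQuat_of_mem]; norm_num)
  calc ‖vecQuat (((fun U : Matrix.specialUnitaryGroup (Fin 2) ℂ => U * (gaussUnit (geodesicKick c J (vecQuat ((U : Matrix.specialUnitaryGroup (Fin 2) ℂ) : Matrix (Fin 2) (Fin 2) ℂ))))⁻¹ * U')^[n] U₀ : Matrix.specialUnitaryGroup (Fin 2) ℂ) : Matrix (Fin 2) (Fin 2) ℂ) -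
          vecQuat ((Ustar : Matrix.specialUnitaryGroup (Fin 2) ℂ) : Matrix (Fin 2) (Fin 2) ℂ)‖
      ≤ (|c| * ‖J‖) ^ n * ‖vecQuat ((U₀ : Matrix.specialUnitaryGroup (Fin 2) ℂ) : Matrix (Fin 2) (Fin 2) ℂ) - vecQuat ((Ustar : Matrix.specialUnitaryGroup (Fin 2) ℂ) : Matrix (Fin 2) (Fin 2) ℂ)‖ :=
        su2FixedPoint_iterate_le c J U' Ustar U₀ hstar n
    _ ≤ (|c| * ‖J‖) ^ n * 2 := mul_le_mul_of_nonneg_left h2 (pow_nonneg (mul_nonneg (abs_nonneg c) (norm_nonneg J)) n)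
    _ = 2 * (|c| * ‖J‖) ^ n := mul_comm _ _

end FixedPoint

end Summit.Ventures.LatticeQCDFlow.Exactness
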